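import Literature.NumberTheory.Weil1964.LocalWeilIndexDegenerate
import Mathlib.LinearAlgebra.QuadraticForm.Prod
import Mathlib.LinearAlgebra.Dual.Lemmas
import Mathlib.LinearAlgebra.Projection
import HarnessLib

/-!
# The Weil index of a quadratic form on an abstract finite-dimensional space; split forms

Topic `NumberTheory/Weil1964`; namespace `Literature.NumberTheory.Weil1964`. KERNEL mathematics only (plumbing
definitions with bodies + theorems; no named fact, no `axiom`, no `sorry`). Sequel of `LocalWeilIndexDegenerate.lean`
(`weilIndexQF' ψ μ f`, the Weil index of an ARBITRARY quadratic form `f` on a coordinate space `F^ι`, `F` a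
non-archimedean local field of characteristic `≠ 2`, = the index of its non-degenerate quotient,
[Rangarao1993] Appendix Thm A.3).

The Leray invariant of a triple of Lagrangians ([Rangarao1993] §2.2–2.3, [MoeglinVignerasWaldspurger1987] Chap. 3 §I.3) and Kashiwara's
quadratic form `Q(x₁ + x₂ + x₃) = B(x₁, x₂) + B(x₂, x₃) + B(x₃, x₁)` on `ℓ₁ ⊕ ℓ₂ ⊕ ℓ₃` ([LionVergne1980] 1.5.1; the
tree's `Literature.LinearAlgebra.QuadraticForm.kashiwaraForm`) are quadratic forms on ABSTRACT finite-dimensional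
spaces, in general degenerate. This file supplies the basis-free index they are fed to:

* §1 `weilIndexQF'` is invariant under linear equivalences `F^ι ≃ F^{ι'}` between coordinate spaces of different
  index types (`weilIndexQF'_comp_linearEquiv'`; [Rangarao1993] Thm A.2 (1) "`γ(f ∘ α) = γ(f)`");
* §2 **`weilIndexSpace ψ μ Q`** for `Q : QuadraticForm F V`, `V` finite-dimensional: `weilIndexQF'` of the coordinate
  expression of `Q` in a basis — equal to `weilIndexQF' ψ μ (Q.basisRepr b)` for EVERY finite basis `b`
  (`weilIndexSpace_eq_basisRepr`), to `weilIndexQF'` itself on `F^ι`; invariant under `Q ↦ Q ∘ e` for linear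
  equivalences `e` and under `QuadraticMap.Equivalent`; `|γ| = 1`; `γ(0) = 1`; `γ(-Q) = conj γ(Q)`
  ([Rangarao1993] Thm A.2 (2)); **`γ(Q₁ ⊕ Q₂) = γ(Q₁) γ(Q₂)`** for `QuadraticMap.prod` ([Rangarao1993] Thm A.2 (3));
  `γ(Q ⊕ -Q) = 1`; independence of the Haar measure;
* §3 **SPLIT FORMS HAVE INDEX `1`**: if `Q` is a quadratic form on `M × N` vanishing identically on `M × 0` and on
  `0 × N` (two complementary totally isotropic subspaces — e.g. the form `(u, v) ↦ B(u, v)` on `ℓ × ℓ'` for two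
  isotropic subspaces of an alternating form, which is how such forms arise from Kashiwara's `Q`), then
  `γ(Q) = 1` (`weilIndexSpace_eq_one_of_split`). Proof: `Q(m, n) = β(m, n)` for the bilinear cross term `β`;
  splitting off the left and right kernels of `β` (radical directions do not change `γ`, Thm A.3) leaves a PERFECT
  pairing `M₁ × N₁ → F`, which in a basis of `M₁` and the dual basis of `N₁` is `Σᵢ xᵢ yᵢ`, i.e. (characteristic
  `≠ 2`, `xy = ((x+y)/2)² - ((x-y)/2)²`) the diagonal form with weights `(1, …, 1, -1, …, -1)`, of index
  `Π γ(1) γ(-1) = 1` ([Weil1964] n° 25: "si `f` est … une forme triviale … `γ(f) = 1`"; [Rangarao1993] Thm A.2: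
  the Weil index factors through the Witt group, where split spaces are `0`).

## References

* [Rangarao1993] R. Ranga Rao, *On some explicit formulas in the theory of Weil representation*, Pacific J. Math.
  157 (1993) 335–371, Appendix Thm A.2 (1)–(3), Thm A.3 (pp. 366–367); §2.2–2.3 (Leray invariant).
* [Weil1964] A. Weil, *Sur certains groupes d'opérateurs unitaires*, Acta Math. 111 (1964), Chap. II n° 25 p. 173.
* [MoeglinVignerasWaldspurger1987] C. Mœglin, M.-F. Vignéras, J.-L. Waldspurger, *Correspondances de Howe sur un corps p-adique*, LNM 1291
  (1987), Chap. 3 §I.3 (invariant de Leray; cocycle métaplectique `c(g, g') = γ(ψ ∘ ½ q(g, g'))`).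
* [LionVergne1980] G. Lion, M. Vergne, *The Weil representation, Maslov index and Theta series*, PM 6 (1980), §1.5.1.
-/

set_option autoImplicit false

noncomputable section

open MeasureTheory QuadraticMap Module
open scoped Classical

namespace Literature.NumberTheory.Weil1964

/-! ## §1 Transport of `weilIndexQF'` between coordinate spaces with different index types -/

section Reindex

variable {F : Type*} [Field F] [ValuativeRel F] [TopologicalSpace F] [IsNonarchimedeanLocalField F]
variable [MeasurableSpace F] [BorelSpace F] (μ : Measure F) [μ.IsAddHaarMeasure] {ψ : AddChar F Circle}
  [Invertible (2 : F)]

omit [BorelSpace F] [μ.IsAddHaarMeasure] [Invertible (2 : F)] in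
/-- re-indexing the coefficients of a diagonal form along `σ : ι ≃ ι'` does not change `Π_{c ≠ 0} γ(c)`.
[cite: Rangarao1993, Appendix Thm A.3, p. 367] -/
theorem weilIndexDiag_comp_equiv {ι ι' : Type*} [Fintype ι] [Fintype ι'] (c' : ι' → F) (σ : ι ≃ ι') :
    weilIndexDiag ψ μ (c' ∘ σ) = weilIndexDiag ψ μ c' := by
  rw [weilIndexDiag, weilIndexDiag]
  let e : coeffSupport (c' ∘ σ) ≃ coeffSupport c' :=
    { toFun := fun i => ⟨σ i.1, i.2⟩
      invFun := fun j => ⟨σ.symm j.1, by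
        change c' (σ (σ.symm j.1)) ≠ 0
        rw [σ.apply_symm_apply]
        exact j.2⟩
      left_inv := fun i => Subtype.ext (σ.symm_apply_apply i.1)
      right_inv := fun j => Subtype.ext (σ.apply_symm_apply j.1) }
  exact Fintype.prod_equiv e _ _ fun i => rfl

/-- **`γ'(f ∘ E) = γ'(f)` for a linear equivalence `E : F^ι ≃ F^{ι'}` between coordinate spaces of possibly
different index types** (the case `ι = ι'` is `weilIndexQF'_comp_linearEquiv`): transport a diagonalisation of `f`
and re-index its coefficients by a bijection `ι ≃ ι'` (which exists, the dimensions being equal).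
[cite: Rangarao1993, Appendix Thm A.2 (1), p. 366] -/
theorem weilIndexQF'_comp_linearEquiv' {ι ι' : Type*} [Fintype ι] [Fintype ι'] (hψ : ψ.IsContinuousNontrivial)
    (Q : QuadraticForm F (ι' → F)) (E : (ι → F) ≃ₗ[F] (ι' → F)) :
    weilIndexQF' ψ μ (Q.comp (E : (ι → F) →ₗ[F] (ι' → F))) = weilIndexQF' ψ μ Q := by
  obtain ⟨c', A', hQA'⟩ := exists_weightedSumSquares_linearEquiv' Q
  have hcard : Fintype.card ι = Fintype.card ι' := by
    have h := E.finrank_eq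
    rwa [Module.finrank_fintype_fun_eq_card, Module.finrank_fintype_fun_eq_card] at h
  let σ : ι ≃ ι' := Fintype.equivOfCardEq hcard
  -- `f ∘ E = (Σ (c' ∘ σ)ᵢ xᵢ²) ∘ B` with `B = (re-index by σ) ∘ A' ∘ E ∈ GL(F^ι)`
  let B : (ι → F) ≃ₗ[F] (ι → F) := (E.trans A').trans (LinearEquiv.funCongrLeft F F σ)
  have hB : ∀ x i, B x i = A' (E x) (σ i) := fun x i => rfl
  have hQB : ∀ x, Q.comp (E : (ι → F) →ₗ[F] (ι' → F)) x = weightedSumSquares F (c' ∘ σ) (B x) := by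
    intro x
    rw [QuadraticMap.comp_apply, LinearEquiv.coe_coe, hQA', weightedSumSquares_apply, weightedSumSquares_apply]
    simp only [hB, Function.comp_apply]
    exact (Fintype.sum_equiv σ (fun i => c' (σ i) • (A' (E x) (σ i) * A' (E x) (σ i)))
      (fun j => c' j • (A' (E x) j * A' (E x) j)) fun i => rfl).symm
  rw [weilIndexQF'_eq_weilIndexDiag μ hψ hQB, weilIndexQF'_eq_weilIndexDiag μ hψ hQA', weilIndexDiag_comp_equiv]

end Reindex

/-! ## §2 The Weil index of a quadratic form on an abstract finite-dimensional space -/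

section Defs

variable {F : Type*} [Field F] [ValuativeRel F] [TopologicalSpace F] [IsNonarchimedeanLocalField F]
  (ψ : AddChar F Circle) [MeasurableSpace F] (μ : Measure F) [Invertible (2 : F)]

/-- **the Weil index `γ(Q)` of a quadratic form on an abstract finite-dimensional `F`-space** (possibly degenerate;
`F` a non-archimedean local field of characteristic `≠ 2`): the index `weilIndexQF'` of its coordinate expression in a
basis — independent of the basis (`weilIndexSpace_eq_basisRepr`). This is the form in which the index of a Leray
invariant / of Kashiwara's form is taken. [cite: Rangarao1993, Appendix Thm A.2 (1) and Thm A.3, pp. 366–367] -/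
def weilIndexSpace {V : Type*} [AddCommGroup V] [Module F V] [FiniteDimensional F V] (Q : QuadraticForm F V) : ℂ :=
  weilIndexQF' ψ μ (Q.basisRepr (Module.finBasis F V))

/-- unfolding. [cite: Rangarao1993, Appendix Thm A.3, p. 367] -/
theorem weilIndexSpace_def {V : Type*} [AddCommGroup V] [Module F V] [FiniteDimensional F V]
    (Q : QuadraticForm F V) : weilIndexSpace ψ μ Q = weilIndexQF' ψ μ (Q.basisRepr (Module.finBasis F V)) := rfl

end Defs

section ProdBasis

variable {F : Type*} [Field F]
variable {M : Type*} {N : Type*} [AddCommGroup M] [Module F M] [AddCommGroup N] [Module F N]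

/-- coordinates in a product basis: `(b₁ ⊔ b₂)`-coordinates `x` on `ι₁ ⊕ ι₂` give the pair of vectors with
coordinates `x ∘ inl`, `x ∘ inr` (plumbing). [folklore] -/
private theorem prod_equivFun_symm_apply {ι₁ ι₂ : Type*} [Fintype ι₁] [Fintype ι₂] (b₁ : Basis ι₁ F M) (b₂ : Basis ι₂ F N)
    (x : ι₁ ⊕ ι₂ → F) :
    (b₁.prod b₂).equivFun.symm x = (b₁.equivFun.symm fun i => x (Sum.inl i), b₂.equivFun.symm fun j => x (Sum.inr j)) := by
  simp only [Basis.equivFun_symm_apply, Fintype.sum_sum_type]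
  refine Prod.ext ?_ ?_
  · simp only [Prod.fst_add, Prod.fst_sum, Prod.smul_fst, Basis.prod_apply_inl_fst, Basis.prod_apply_inr_fst,
      smul_zero, Finset.sum_const_zero, add_zero]
  · simp only [Prod.snd_add, Prod.snd_sum, Prod.smul_snd, Basis.prod_apply_inl_snd, Basis.prod_apply_inr_snd,
      smul_zero, Finset.sum_const_zero, zero_add]

end ProdBasis

section Space

variable {F : Type*} [Field F] [ValuativeRel F] [TopologicalSpace F] [IsNonarchimedeanLocalField F]
variable [MeasurableSpace F] [BorelSpace F] (μ : Measure F) [μ.IsAddHaarMeasure] {ψ : AddChar F Circle}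
  [Invertible (2 : F)]
variable {V : Type*} [AddCommGroup V] [Module F V] [FiniteDimensional F V]
variable {V' : Type*} [AddCommGroup V'] [Module F V'] [FiniteDimensional F V']

omit [ValuativeRel F] [TopologicalSpace F] [IsNonarchimedeanLocalField F] [MeasurableSpace F] [BorelSpace F]
  [Invertible (2 : F)] [FiniteDimensional F V] in
/-- two coordinate expressions of one form differ by the change-of-basis equivalence (plumbing). [folklore] -/
private theorem basisRepr_eq_comp {ι ι' : Type*} [Fintype ι] [Fintype ι'] (Q : QuadraticForm F V) (b : Basis ι F V)
    (b' : Basis ι' F V) :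
    Q.basisRepr b' = (Q.basisRepr b).comp ((b'.equivFun.symm.trans b.equivFun : (ι' → F) ≃ₗ[F] (ι → F)) :
      (ι' → F) →ₗ[F] (ι → F)) := by
  refine QuadraticMap.ext fun x => ?_
  simp only [QuadraticMap.basisRepr, QuadraticMap.comp_apply, LinearEquiv.coe_coe, LinearEquiv.trans_apply,
    LinearEquiv.symm_apply_apply]

/-- **independence of the basis**: `γ(Q) = γ'(Q.basisRepr b)` for EVERY finite basis `b` of `V` (any index type).
[cite: Rangarao1993, Appendix Thm A.2 (1), p. 366] -/
theorem weilIndexSpace_eq_basisRepr (hψ : ψ.IsContinuousNontrivial) (Q : QuadraticForm F V) {ι : Type*} [Fintype ι]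
    (b : Basis ι F V) : weilIndexSpace ψ μ Q = weilIndexQF' ψ μ (Q.basisRepr b) := by
  rw [weilIndexSpace, basisRepr_eq_comp Q b (Module.finBasis F V), weilIndexQF'_comp_linearEquiv' μ hψ]

/-- on a coordinate space `F^ι` the basis-free index is `weilIndexQF'` itself (standard basis).
[cite: Rangarao1993, Appendix Thm A.3, p. 367] -/
theorem weilIndexSpace_eq_weilIndexQF' {ι : Type*} [Fintype ι] (hψ : ψ.IsContinuousNontrivial)
    (Q : QuadraticForm F (ι → F)) : weilIndexSpace ψ μ Q = weilIndexQF' ψ μ Q := by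
  rw [weilIndexSpace_eq_basisRepr μ hψ Q (Pi.basisFun F ι)]
  have h : Q.basisRepr (Pi.basisFun F ι) = Q := QuadraticMap.ext fun x => by
    rw [QuadraticMap.basisRepr_apply]
    have hx := (Pi.basisFun F ι).sum_repr x
    simp only [Pi.basisFun_repr] at hx
    exact congrArg Q hx
  rw [h]

/-- **`γ(Q ∘ e) = γ(Q)` for a linear equivalence `e : V' ≃ V`** (isometric forms have the same index).
[cite: Rangarao1993, Appendix Thm A.2 (1), p. 366] -/
theorem weilIndexSpace_comp_linearEquiv (hψ : ψ.IsContinuousNontrivial) (Q : QuadraticForm F V) (e : V' ≃ₗ[F] V) :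
    weilIndexSpace ψ μ (Q.comp (e : V' →ₗ[F] V)) = weilIndexSpace ψ μ Q := by
  let b := Module.finBasis F V
  let b' : Basis (Fin (finrank F V)) F V' := b.map e.symm
  have h : (Q.comp (e : V' →ₗ[F] V)).basisRepr b' = Q.basisRepr b := by
    refine QuadraticMap.ext fun x => ?_
    rw [QuadraticMap.basisRepr_apply, QuadraticMap.basisRepr_apply, QuadraticMap.comp_apply, LinearEquiv.coe_coe,
      map_sum]
    simp only [b', map_smul, Basis.map_apply, LinearEquiv.apply_symm_apply]
  rw [weilIndexSpace_eq_basisRepr μ hψ _ b', h, weilIndexSpace_eq_basisRepr μ hψ Q b]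

/-- **equivalent quadratic forms have the same Weil index** (`QuadraticMap.Equivalent`, i.e. isometric, possibly on
different spaces). [cite: Rangarao1993, Appendix Thm A.2 (1), p. 366] -/
theorem weilIndexSpace_eq_of_equivalent (hψ : ψ.IsContinuousNontrivial) {Q : QuadraticForm F V}
    {Q' : QuadraticForm F V'} (h : Q.Equivalent Q') : weilIndexSpace ψ μ Q = weilIndexSpace ψ μ Q' := by
  obtain ⟨e⟩ := h
  have hQ : Q = Q'.comp (e.toLinearEquiv : V →ₗ[F] V') := by
    refine QuadraticMap.ext fun x => ?_
    rw [QuadraticMap.comp_apply]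
    exact (e.map_app x).symm
  rw [hQ, weilIndexSpace_comp_linearEquiv μ hψ Q' e.toLinearEquiv]

/-- **`|γ(Q)| = 1`**. [cite: Weil1964, Chap. II n° 24, p. 173] -/
theorem norm_weilIndexSpace (hψ : ψ.IsContinuousNontrivial) (Q : QuadraticForm F V) : ‖weilIndexSpace ψ μ Q‖ = 1 :=
  norm_weilIndexQF' μ hψ _

/-- `γ(Q) ≠ 0`. [cite: Weil1964, Chap. II n° 24, p. 173] -/
theorem weilIndexSpace_ne_zero (hψ : ψ.IsContinuousNontrivial) (Q : QuadraticForm F V) : weilIndexSpace ψ μ Q ≠ 0 := by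
  intro h
  have h1 := norm_weilIndexSpace μ hψ Q
  rw [h, norm_zero] at h1
  exact zero_ne_one h1

/-- `γ(Q) · conj γ(Q) = 1` (unit modulus). [cite: Weil1964, Chap. II n° 24, p. 173] -/
theorem weilIndexSpace_mul_conj (hψ : ψ.IsContinuousNontrivial) (Q : QuadraticForm F V) :
    weilIndexSpace ψ μ Q * (starRingEnd ℂ) (weilIndexSpace ψ μ Q) = 1 := by
  rw [Complex.mul_conj, Complex.normSq_eq_norm_sq, norm_weilIndexSpace μ hψ Q]
  norm_num

/-- **the zero form has index `1`**. [cite: Rangarao1993, Appendix Thm A.3, p. 367] -/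
theorem weilIndexSpace_zero (hψ : ψ.IsContinuousNontrivial) : weilIndexSpace ψ μ (0 : QuadraticForm F V) = 1 := by
  rw [weilIndexSpace]
  have h : (0 : QuadraticForm F V).basisRepr (Module.finBasis F V) = 0 := QuadraticMap.ext fun x => by
    rw [QuadraticMap.basisRepr_apply, QuadraticMap.zero_apply, QuadraticMap.zero_apply]
  rw [h, weilIndexQF'_zero μ hψ]

/-- **`γ(-Q) = conj γ(Q)`**. [cite: Rangarao1993, Appendix Thm A.2 (2), p. 366] -/
theorem weilIndexSpace_neg (hψ : ψ.IsContinuousNontrivial) (Q : QuadraticForm F V) :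
    weilIndexSpace ψ μ (-Q) = (starRingEnd ℂ) (weilIndexSpace ψ μ Q) := by
  rw [weilIndexSpace, weilIndexSpace]
  have h : (-Q).basisRepr (Module.finBasis F V) = -(Q.basisRepr (Module.finBasis F V)) :=
    QuadraticMap.ext fun x => by
      rw [QuadraticMap.basisRepr_apply, QuadraticMap.neg_apply, QuadraticMap.neg_apply, QuadraticMap.basisRepr_apply]
  rw [h, weilIndexQF'_neg μ hψ]

/-- **`γ` does not depend on the Haar measure**. [cite: Weil1964, Chap. II n° 24, p. 173] -/
theorem weilIndexSpace_eq_of_isAddHaarMeasure (μ' : Measure F) [μ'.IsAddHaarMeasure] (hψ : ψ.IsContinuousNontrivial)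
    (Q : QuadraticForm F V) : weilIndexSpace ψ μ' Q = weilIndexSpace ψ μ Q :=
  weilIndexQF'_eq_of_isAddHaarMeasure μ μ' hψ _

/-- **orthogonal sums: `γ(Q₁ ⊕ Q₂) = γ(Q₁) γ(Q₂)`** for Mathlib's `QuadraticMap.prod` on `V × V'` (no non-degeneracy
needed). [cite: Rangarao1993, Appendix Thm A.2 (3), p. 366] -/
theorem weilIndexSpace_prod (hψ : ψ.IsContinuousNontrivial) (Q₁ : QuadraticForm F V) (Q₂ : QuadraticForm F V') :
    weilIndexSpace ψ μ (Q₁.prod Q₂) = weilIndexSpace ψ μ Q₁ * weilIndexSpace ψ μ Q₂ := by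
  let b₁ := Module.finBasis F V
  let b₂ := Module.finBasis F V'
  let b := b₁.prod b₂
  have hsum : ∀ x : Fin (finrank F V) ⊕ Fin (finrank F V') → F, (Q₁.prod Q₂).basisRepr b x =
      Q₁.basisRepr b₁ (fun i => x (Sum.inl i)) + Q₂.basisRepr b₂ (fun j => x (Sum.inr j)) := by
    intro x
    simp only [QuadraticMap.basisRepr, QuadraticMap.comp_apply, LinearEquiv.coe_coe, b, prod_equivFun_symm_apply,
      QuadraticMap.prod_apply]
  rw [weilIndexSpace_eq_basisRepr μ hψ _ b, weilIndexQF'_sum μ hψ hsum, ← weilIndexSpace_eq_basisRepr μ hψ Q₁ b₁,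
    ← weilIndexSpace_eq_basisRepr μ hψ Q₂ b₂]

/-- **`γ(Q ⊕ -Q) = 1`** (Witt-trivial sums). [cite: Rangarao1993, Appendix Thm A.2 (2)–(3), p. 366] -/
theorem weilIndexSpace_prod_neg_self (hψ : ψ.IsContinuousNontrivial) (Q : QuadraticForm F V) :
    weilIndexSpace ψ μ (Q.prod (-Q)) = 1 := by
  rw [weilIndexSpace_prod μ hψ, weilIndexSpace_neg μ hψ, weilIndexSpace_mul_conj μ hψ]

/-- `γ(Q₁ ⊕ 0) = γ(Q₁)` (radical directions do not change the index). [cite: Rangarao1993, Appendix Thm A.3, p. 367] -/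
theorem weilIndexSpace_prod_zero (hψ : ψ.IsContinuousNontrivial) (Q : QuadraticForm F V) :
    weilIndexSpace ψ μ (Q.prod (0 : QuadraticForm F V')) = weilIndexSpace ψ μ Q := by
  rw [weilIndexSpace_prod μ hψ, weilIndexSpace_zero μ hψ, mul_one]

end Space

/-! ## §3 Split forms have index `1` -/

section Split

variable {F : Type*} [Field F] [ValuativeRel F] [TopologicalSpace F] [IsNonarchimedeanLocalField F]
variable [MeasurableSpace F] [BorelSpace F] (μ : Measure F) [μ.IsAddHaarMeasure] {ψ : AddChar F Circle}
  [Invertible (2 : F)]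
variable {M : Type*} {N : Type*} [AddCommGroup M] [Module F M] [AddCommGroup N] [Module F N]

/-- **the quadratic form `(m, n) ↦ β(m, n)` on `M × N` of a bilinear pairing `β : M × N → F`** — the shape of the
cross term "`H(u, v) = B(u, v)` on `ℓ₁ × ℓ₃`" of Kashiwara's form for two isotropic subspaces.
[cite: LionVergne1980, §1.5.4 (proof)] -/
def pairingQF (β : M →ₗ[F] N →ₗ[F] F) : QuadraticForm F (M × N) :=
  LinearMap.BilinMap.toQuadraticMap (β.compl₁₂ (LinearMap.fst F M N) (LinearMap.snd F M N))

omit [ValuativeRel F] [TopologicalSpace F] [IsNonarchimedeanLocalField F] [MeasurableSpace F] [BorelSpace F]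
  [Invertible (2 : F)] in
/-- `pairingQF β (m, n) = β m n` ("`H(u, v) = B(u, v)`"). [cite: LionVergne1980, §1.5.4 (proof)] -/
@[simp] theorem pairingQF_apply (β : M →ₗ[F] N →ₗ[F] F) (x : M × N) : pairingQF β x = β x.1 x.2 := rfl

omit [ValuativeRel F] [TopologicalSpace F] [IsNonarchimedeanLocalField F] [MeasurableSpace F] [BorelSpace F]
  [Invertible (2 : F)] in
/-- a form on `M × N` vanishing on `M × 0` and on `0 × N` is the pairing form of its cross term
`β(m, n) = polar Q ((m, 0), (0, n))` (plumbing for `weilIndexSpace_eq_one_of_split`). [folklore] -/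
private theorem eq_pairingQF_of_split (Q : QuadraticForm F (M × N)) (hM : ∀ m, Q (m, 0) = 0) (hN : ∀ n, Q (0, n) = 0) :
    Q = pairingQF ((QuadraticMap.polarBilin Q).compl₁₂ (LinearMap.inl F M N) (LinearMap.inr F M N)) := by
  refine QuadraticMap.ext fun x => ?_
  obtain ⟨m, n⟩ := x
  simp only [pairingQF_apply, LinearMap.compl₁₂_apply, LinearMap.inl_apply, LinearMap.inr_apply,
    QuadraticMap.polarBilin_apply_apply, QuadraticMap.polar, hM, hN, sub_zero, Prod.mk_add_mk, add_zero, zero_add]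

/-- `(x, y) ↦ (½(x + y), ½(x - y))` in each pair of coordinates `(inl i, inr i)` of `F^{ι ⊔ ι}`, an automorphism with
inverse `(u, v) ↦ (u + v, u - v)`. [folklore] -/
def hyperbolicRotation (ι : Type*) : (ι ⊕ ι → F) ≃ₗ[F] (ι ⊕ ι → F) where
  toFun x k := Sum.elim (fun i => ⅟(2 : F) * (x (Sum.inl i) + x (Sum.inr i)))
    (fun i => ⅟(2 : F) * (x (Sum.inl i) - x (Sum.inr i))) k
  invFun y k := Sum.elim (fun i => y (Sum.inl i) + y (Sum.inr i)) (fun i => y (Sum.inl i) - y (Sum.inr i)) k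
  map_add' x x' := by
    funext k
    rcases k with i | i
    · simp only [Sum.elim_inl, Pi.add_apply]
      ring
    · simp only [Sum.elim_inr, Pi.add_apply]
      ring
  map_smul' c x := by
    funext k
    rcases k with i | i
    · simp only [Sum.elim_inl, Pi.smul_apply, smul_eq_mul, RingHom.id_apply]
      ring
    · simp only [Sum.elim_inr, Pi.smul_apply, smul_eq_mul, RingHom.id_apply]
      ring
  left_inv x := by
    have h2 : ⅟(2 : F) * 2 = 1 := invOf_mul_self _
    funext k
    rcases k with i | i
    · simp only [Sum.elim_inl, Sum.elim_inr]
      linear_combination (x (Sum.inl i)) * h2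
    · simp only [Sum.elim_inl, Sum.elim_inr]
      linear_combination (x (Sum.inr i)) * h2
  right_inv y := by
    have h2 : ⅟(2 : F) * 2 = 1 := invOf_mul_self _
    funext k
    rcases k with i | i
    · simp only [Sum.elim_inl, Sum.elim_inr]
      linear_combination (y (Sum.inl i)) * h2
    · simp only [Sum.elim_inl, Sum.elim_inr]
      linear_combination (y (Sum.inr i)) * h2

omit [ValuativeRel F] [TopologicalSpace F] [IsNonarchimedeanLocalField F] [MeasurableSpace F] [BorelSpace F] in
/-- **`Σᵢ xᵢ yᵢ = Σᵢ uᵢ² - Σᵢ vᵢ²` with `u = ½(x + y)`, `v = ½(x - y)`**: the hyperbolic form is the diagonal form with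
weights `(1, …, 1, -1, …, -1)` after the rotation (characteristic `≠ 2`). [cite: Weil1964, Chap. II n° 25, p. 173] -/
theorem sum_mul_eq_weightedSumSquares_hyperbolicRotation {ι : Type*} [Fintype ι] (x : ι ⊕ ι → F) :
    ∑ i, x (Sum.inl i) * x (Sum.inr i) =
      weightedSumSquares F (Sum.elim (fun _ : ι => (1 : F)) (fun _ : ι => (-1 : F))) (hyperbolicRotation ι x) := by
  have h2 : ⅟(2 : F) * 2 = 1 := invOf_mul_self _
  rw [weightedSumSquares_apply, Fintype.sum_sum_type, ← Finset.sum_add_distrib]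
  refine Finset.sum_congr rfl fun i _ => ?_
  simp only [Sum.elim_inl, Sum.elim_inr, smul_eq_mul, one_mul, neg_mul]
  change x (Sum.inl i) * x (Sum.inr i) =
    ⅟(2 : F) * (x (Sum.inl i) + x (Sum.inr i)) * (⅟(2 : F) * (x (Sum.inl i) + x (Sum.inr i))) +
      -(⅟(2 : F) * (x (Sum.inl i) - x (Sum.inr i)) * (⅟(2 : F) * (x (Sum.inl i) - x (Sum.inr i))))
  linear_combination (-(x (Sum.inl i) * x (Sum.inr i) * (2 * ⅟(2 : F) + 1))) * h2

/-- **the hyperbolic form `Σᵢ xᵢ yᵢ` has Weil index `1`**: `Π γ(1) · Π γ(-1) = Π (γ(1) γ(-1)) = 1`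
("une forme triviale … `γ(f) = 1`"). [cite: Weil1964, Chap. II n° 25, p. 173] -/
theorem weilIndexQF'_eq_one_of_hyperbolic {ι : Type*} [Fintype ι] (hψ : ψ.IsContinuousNontrivial)
    {Q : QuadraticForm F (ι ⊕ ι → F)} (hQ : ∀ x, Q x = ∑ i, x (Sum.inl i) * x (Sum.inr i)) :
    weilIndexQF' ψ μ Q = 1 := by
  have htwo : (2 : F) ≠ 0 := Invertible.ne_zero 2
  have hQ' : ∀ x, Q x = weightedSumSquares F (Sum.elim (fun _ : ι => (1 : F)) (fun _ : ι => (-1 : F)))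
      (hyperbolicRotation ι x) := fun x => by rw [hQ, sum_mul_eq_weightedSumSquares_hyperbolicRotation]
  have hne : ∀ k : ι ⊕ ι, Sum.elim (fun _ : ι => (1 : F)) (fun _ : ι => (-1 : F)) k ≠ 0 := by
    intro k
    rcases k with i | i
    · simp
    · simp
  rw [weilIndexQF'_eq_weilIndexDiag μ hψ hQ', weilIndexDiag_of_ne_zero ψ μ hne, Fintype.prod_sum_type]
  simp only [Sum.elim_inl, Sum.elim_inr]
  rw [← Finset.prod_mul_distrib]
  refine Finset.prod_eq_one fun i _ => ?_
  rw [mul_comm]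
  exact weilIndex_neg_mul_self μ hψ one_ne_zero htwo

variable [FiniteDimensional F M] [FiniteDimensional F N]

/-- **a PERFECT pairing has index `1`**: if `β : M × N → F` has trivial left and right kernels then, in a basis `e`
of `M` and the `β`-dual basis `f` of `N` (`β(eᵢ, fⱼ) = δᵢⱼ`), `pairingQF β = Σᵢ xᵢ yᵢ` is hyperbolic.
[cite: Weil1964, Chap. II n° 25, p. 173] -/
theorem weilIndexSpace_pairingQF_of_ker_eq_bot (hψ : ψ.IsContinuousNontrivial) (β : M →ₗ[F] N →ₗ[F] F)
    (hl : LinearMap.ker β = ⊥) (hr : LinearMap.ker β.flip = ⊥) : weilIndexSpace ψ μ (pairingQF β) = 1 := by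
  -- `β.flip : N ≃ Dual M` (injective both ways, so the dimensions agree)
  have hinj : Function.Injective β.flip := LinearMap.ker_eq_bot.1 hr
  have hinj' : Function.Injective β := LinearMap.ker_eq_bot.1 hl
  have h₁ : finrank F N ≤ finrank F (Module.Dual F M) := LinearMap.finrank_le_finrank_of_injective hinj
  have h₂ : finrank F M ≤ finrank F (Module.Dual F N) := LinearMap.finrank_le_finrank_of_injective hinj'
  rw [Subspace.dual_finrank_eq] at h₁ h₂
  have heq : finrank F N = finrank F (Module.Dual F M) := by
    rw [Subspace.dual_finrank_eq]
    exact le_antisymm h₁ h₂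
  have hsurj : Function.Surjective β.flip := (LinearMap.injective_iff_surjective_of_finrank_eq_finrank heq).1 hinj
  let Φ : N ≃ₗ[F] Module.Dual F M := LinearEquiv.ofBijective β.flip ⟨hinj, hsurj⟩
  have hΦ : ∀ n, Φ n = β.flip n := fun n => rfl
  -- a basis of `M` and its `β`-dual basis of `N`
  let e : Basis (Fin (finrank F M)) F M := Module.finBasis F M
  let f : Basis (Fin (finrank F M)) F N := e.dualBasis.map Φ.symm
  have hef : ∀ i j, β (e i) (f j) = if i = j then 1 else 0 := by
    intro i j
    have h1 : β (e i) (f j) = Φ (f j) (e i) := by rw [hΦ, LinearMap.flip_apply]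
    rw [h1]
    simp only [f, Basis.map_apply, LinearEquiv.apply_symm_apply, Basis.dualBasis_apply_self]
  -- in the basis `e ⊔ f` the form is `Σᵢ xᵢ yᵢ`
  have hval : ∀ x : Fin (finrank F M) ⊕ Fin (finrank F M) → F,
      (pairingQF β).basisRepr (e.prod f) x = ∑ i, x (Sum.inl i) * x (Sum.inr i) := by
    intro x
    rw [QuadraticMap.basisRepr, QuadraticMap.comp_apply, LinearEquiv.coe_coe, prod_equivFun_symm_apply,
      pairingQF_apply]
    simp only [Basis.equivFun_symm_apply, map_sum, map_smul, LinearMap.sum_apply, LinearMap.smul_apply, hef,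
      smul_eq_mul, mul_ite, mul_one, mul_zero, Finset.sum_ite_eq', Finset.mem_univ, if_true]
    exact Finset.sum_congr rfl fun i _ => mul_comm _ _
  rw [weilIndexSpace_eq_basisRepr μ hψ _ (e.prod f), weilIndexQF'_eq_one_of_hyperbolic μ hψ hval]

/-- **every pairing form has index `1`**: split off the left kernel `M₀` and the right kernel `N₀` of `β` along
complements `M₁, N₁`; then `pairingQF β ≅ pairingQF β|_{M₁ × N₁} ⊕ 0` with `β|_{M₁ × N₁}` perfect.
[cite: Rangarao1993, Appendix Thm A.3, p. 367] -/
theorem weilIndexSpace_pairingQF (hψ : ψ.IsContinuousNontrivial) (β : M →ₗ[F] N →ₗ[F] F) :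
    weilIndexSpace ψ μ (pairingQF β) = 1 := by
  obtain ⟨M₁, hM⟩ := (LinearMap.ker β).exists_isCompl
  obtain ⟨N₁, hN⟩ := (LinearMap.ker β.flip).exists_isCompl
  set M₀ := LinearMap.ker β with hM₀
  set N₀ := LinearMap.ker β.flip with hN₀
  -- the restricted pairing and the block change of variables
  let β₁ : M₁ →ₗ[F] N₁ →ₗ[F] F := β.compl₁₂ M₁.subtype N₁.subtype
  let E : ((M₁ × N₁) × (M₀ × N₀)) ≃ₗ[F] (M × N) :=
    (LinearEquiv.prodProdProdComm F M₁ N₁ M₀ N₀).trans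
      ((Submodule.prodEquivOfIsCompl M₁ M₀ hM.symm).prodCongr (Submodule.prodEquivOfIsCompl N₁ N₀ hN.symm))
  have hE : ∀ z : (M₁ × N₁) × (M₀ × N₀), E z = ((z.1.1 : M) + (z.2.1 : M), (z.1.2 : N) + (z.2.2 : N)) := by
    intro z
    obtain ⟨⟨m₁, n₁⟩, ⟨m₀, n₀⟩⟩ := z
    rfl
  have hkerM : ∀ (m₀ : M₀) (n : N), β (m₀ : M) n = 0 := fun m₀ n => by
    have h : β (m₀ : M) = 0 := LinearMap.mem_ker.1 m₀.2
    rw [h, LinearMap.zero_apply]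
  have hkerN : ∀ (m : M) (n₀ : N₀), β m (n₀ : N) = 0 := fun m n₀ => by
    have h : β.flip (n₀ : N) = 0 := LinearMap.mem_ker.1 n₀.2
    rw [← LinearMap.flip_apply (f := β), h, LinearMap.zero_apply]
  have hcomp : (pairingQF β).comp (E : ((M₁ × N₁) × (M₀ × N₀)) →ₗ[F] (M × N)) =
      (pairingQF β₁).prod (0 : QuadraticForm F (M₀ × N₀)) := by
    refine QuadraticMap.ext fun z => ?_
    obtain ⟨⟨m₁, n₁⟩, ⟨m₀, n₀⟩⟩ := z
    rw [QuadraticMap.comp_apply, LinearEquiv.coe_coe, hE, pairingQF_apply, QuadraticMap.prod_apply, pairingQF_apply,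
      QuadraticMap.zero_apply, add_zero]
    simp only [map_add, LinearMap.add_apply, hkerM, hkerN, add_zero, β₁, LinearMap.compl₁₂_apply,
      Submodule.subtype_apply]
  -- the restricted pairing is perfect
  have hsplitN : ∀ n : N, ∃ (n₁ : N₁) (n₀ : N₀), n = (n₁ : N) + (n₀ : N) := fun n => by
    have h : n ∈ N₁ ⊔ N₀ := by rw [hN.symm.sup_eq_top]; trivial
    obtain ⟨a, ha, b, hb, hab⟩ := Submodule.mem_sup.1 h
    exact ⟨⟨a, ha⟩, ⟨b, hb⟩, hab.symm⟩
  have hsplitM : ∀ m : M, ∃ (m₁ : M₁) (m₀ : M₀), m = (m₁ : M) + (m₀ : M) := fun m => by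
    have h : m ∈ M₁ ⊔ M₀ := by rw [hM.symm.sup_eq_top]; trivial
    obtain ⟨a, ha, b, hb, hab⟩ := Submodule.mem_sup.1 h
    exact ⟨⟨a, ha⟩, ⟨b, hb⟩, hab.symm⟩
  have hl : LinearMap.ker β₁ = ⊥ := by
    refine LinearMap.ker_eq_bot'.2 fun m₁ hm₁ => ?_
    have hzero : β (m₁ : M) = 0 := by
      refine LinearMap.ext fun n => ?_
      obtain ⟨n₁, n₀, rfl⟩ := hsplitN n
      have h1 : β (m₁ : M) (n₁ : N) = 0 := by
        have := LinearMap.congr_fun hm₁ n₁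
        simpa [β₁] using this
      rw [map_add, h1, hkerN, add_zero, LinearMap.zero_apply]
    have hmem : (m₁ : M) ∈ M₁ ⊓ M₀ := Submodule.mem_inf.2 ⟨m₁.2, LinearMap.mem_ker.2 hzero⟩
    rw [hM.symm.inf_eq_bot, Submodule.mem_bot] at hmem
    exact Subtype.ext hmem
  have hr : LinearMap.ker β₁.flip = ⊥ := by
    refine LinearMap.ker_eq_bot'.2 fun n₁ hn₁ => ?_
    have hzero : β.flip (n₁ : N) = 0 := by
      refine LinearMap.ext fun m => ?_
      obtain ⟨m₁, m₀, rfl⟩ := hsplitM m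
      have h1 : β (m₁ : M) (n₁ : N) = 0 := by
        have := LinearMap.congr_fun hn₁ m₁
        simpa [β₁] using this
      rw [LinearMap.flip_apply, map_add, LinearMap.add_apply, h1, hkerM, add_zero, LinearMap.zero_apply]
    have hmem : (n₁ : N) ∈ N₁ ⊓ N₀ := Submodule.mem_inf.2 ⟨n₁.2, LinearMap.mem_ker.2 hzero⟩
    rw [hN.symm.inf_eq_bot, Submodule.mem_bot] at hmem
    exact Subtype.ext hmem
  rw [← weilIndexSpace_comp_linearEquiv μ hψ (pairingQF β) E, hcomp, weilIndexSpace_prod_zero μ hψ,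
    weilIndexSpace_pairingQF_of_ker_eq_bot μ hψ β₁ hl hr]

/-- **SPLIT FORMS HAVE WEIL INDEX `1`.** If a quadratic form `Q` on `M × N` vanishes identically on `M × 0` and on
`0 × N` (two complementary totally isotropic subspaces), then `γ(Q) = 1` — e.g. `(u, v) ↦ B(u, v)` on `ℓ × ℓ'` for
`ℓ, ℓ'` isotropic for an alternating `B`. (The Weil index factors through the Witt group [Rangarao1993, Thm A.2–A.3],
in which split spaces vanish; [Weil1964] n° 25: a "forme triviale" has `γ = 1`.)
[cite: Rangarao1993, Appendix Thm A.2 (3) and Thm A.3, pp. 366–367] -/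
theorem weilIndexSpace_eq_one_of_split (hψ : ψ.IsContinuousNontrivial) (Q : QuadraticForm F (M × N))
    (hM : ∀ m, Q (m, 0) = 0) (hN : ∀ n, Q (0, n) = 0) : weilIndexSpace ψ μ Q = 1 := by
  rw [eq_pairingQF_of_split Q hM hN]
  exact weilIndexSpace_pairingQF μ hψ _

end Split

end Literature.NumberTheory.Weil1964
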